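import Mathlib
import HarnessLib
import Literature.MathematicalPhysics.QuantumLattice.LatticeScalarField

/-!
# Stub `stub_riemannBound` (crux `SelfNormalisedMomentBoundsR`, line `Sketch`)

Riemann sums of the integrable weight `(1 + ‖·‖)⁻⁸` over an arbitrary finite set of lattice
points of `ℤ⁴` are bounded uniformly in the mesh `0 < a ≤ 1` and the centre `c`:
`a⁴ Σ_{x ∈ Λ} (1 + ‖a x − c‖)⁻⁸ ≤ K`.

Proof: dominate `(1 + ‖v‖)⁻⁸ ≤ ∏_μ (1 + |v μ|)⁻²` coordinatewise, enlarge `Λ` to the product of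
its four coordinate projections and factorise (`Finset.prod_univ_sum`); the one-dimensional
bound `a Σ_{m ∈ T} (1 + |a m − t|)⁻² ≤ 8 Σ_{n ∈ ℤ} (1 + |n|)⁻²` follows by sorting the `m`'s
according to `⌊a m − t⌋` (each fibre has at most `1/a + 1` elements).
-/

noncomputable section

open scoped BigOperators
open Finset
open Literature.Probability.LatticeModels Literature.MathematicalPhysics.QuantumLattice

namespace Summit.QuantumFields.YangMills.Theorems.ScalingWindowSplit.SelfNormalisedMomentBoundsR

/-- The weight `n ↦ (1 + |n|)⁻²` is summable over `ℤ`. -/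
private theorem riemannBound_summable_weight :
    Summable (fun n : ℤ => ((1 + |(n : ℝ)|)⁻¹) ^ 2) := by
  have h1 : Summable (fun n : ℕ => ((1 + (n : ℝ))⁻¹) ^ 2) := by
    have := (summable_nat_add_iff 1).mpr (Real.summable_nat_pow_inv.mpr one_lt_two)
    refine this.congr (fun n => ?_)
    push_cast
    rw [inv_pow]
    ring
  refine Summable.of_nat_of_neg_add_one ?_ ?_
  · simpa [Nat.abs_cast] using h1
  · refine Summable.of_nonneg_of_le (fun n => by positivity) (fun n => ?_) h1
    have habs : |(((-(n + 1 : ℤ)) : ℤ) : ℝ)| = (n : ℝ) + 1 := by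
      push_cast
      rw [abs_neg]
      exact abs_of_nonneg (by positivity)
    rw [habs]
    apply pow_le_pow_left₀ (by positivity)
    exact inv_anti₀ (by positivity) (by linarith)

/-- Pointwise comparison of the weight at `u` with the weight at `⌊u⌋`. -/
private theorem riemannBound_weight_le_floor (u : ℝ) :
    ((1 + |u|)⁻¹) ^ 2 ≤ 4 * ((1 + |((⌊u⌋ : ℤ) : ℝ)|)⁻¹) ^ 2 := by
  have hfl1 : ((⌊u⌋ : ℤ) : ℝ) ≤ u := Int.floor_le u
  have hfl2 : u < ((⌊u⌋ : ℤ) : ℝ) + 1 := Int.lt_floor_add_one u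
  have habs : |((⌊u⌋ : ℤ) : ℝ)| ≤ 1 + |u| := by
    rw [abs_le]
    constructor
    · have := neg_abs_le u
      linarith
    · have := le_abs_self u
      linarith
  have hpos : 0 < 1 + |u| := by positivity
  have hpos' : 0 < 1 + |((⌊u⌋ : ℤ) : ℝ)| := by positivity
  calc ((1 + |u|)⁻¹) ^ 2 ≤ (2 * (1 + |((⌊u⌋ : ℤ) : ℝ)|)⁻¹) ^ 2 := by
        apply pow_le_pow_left₀ (by positivity)
        rw [← div_eq_mul_inv, le_div_iff₀ hpos', inv_mul_le_iff₀ hpos]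
        have := abs_nonneg u
        linarith
    _ = 4 * ((1 + |((⌊u⌋ : ℤ) : ℝ)|)⁻¹) ^ 2 := by ring

/-- Each fibre of `m ↦ ⌊a m − t⌋` on the integers has at most `1/a + 1` elements. -/
private theorem riemannBound_card_fiber_le (a t : ℝ) (ha : 0 < a) (T : Finset ℤ) (n : ℤ) :
    ((#{m ∈ T | ⌊a * ((m : ℤ) : ℝ) - t⌋ = n} : ℕ) : ℝ) ≤ 1 / a + 1 := by
  have hsub : {m ∈ T | ⌊a * ((m : ℤ) : ℝ) - t⌋ = n} ⊆
      Finset.Ico ⌈((n : ℝ) + t) / a⌉ ⌈((n : ℝ) + t + 1) / a⌉ := by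
    intro m hm
    rw [Finset.mem_filter] at hm
    obtain ⟨-, hmn⟩ := hm
    have h1 : ((n : ℤ) : ℝ) ≤ a * m - t := by
      rw [← hmn]
      exact Int.floor_le _
    have h2 : a * m - t < n + 1 := by
      have := Int.lt_floor_add_one (a * m - t)
      rw [hmn] at this
      exact_mod_cast this
    rw [Finset.mem_Ico]
    constructor
    · rw [Int.ceil_le, div_le_iff₀ ha]
      linarith [mul_comm a (m : ℝ)]
    · rw [Int.lt_ceil, lt_div_iff₀ ha]
      linarith [mul_comm a (m : ℝ)]
  have hc := Finset.card_le_card hsub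
  rw [Int.card_Ico] at hc
  have hceil : ⌈((n : ℝ) + t + 1) / a⌉ - ⌈((n : ℝ) + t) / a⌉ ≤ ⌈1 / a⌉ := by
    have := Int.ceil_add_le (((n : ℝ) + t) / a) (1 / a)
    rw [show ((n : ℝ) + t + 1) / a = ((n : ℝ) + t) / a + 1 / a by ring]
    linarith
  have h3 : (((⌈((n : ℝ) + t + 1) / a⌉ - ⌈((n : ℝ) + t) / a⌉).toNat : ℕ) : ℤ) ≤ ⌈1 / a⌉ := by
    rcases le_or_gt 0 (⌈((n : ℝ) + t + 1) / a⌉ - ⌈((n : ℝ) + t) / a⌉) with h | h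
    · rw [Int.toNat_of_nonneg h]
      exact hceil
    · rw [Int.toNat_eq_zero.mpr h.le]
      push_cast
      positivity
  have h4 : ((⌈1 / a⌉ : ℤ) : ℝ) < 1 / a + 1 := Int.ceil_lt_add_one _
  calc ((#{m ∈ T | ⌊a * ((m : ℤ) : ℝ) - t⌋ = n} : ℕ) : ℝ)
      ≤ (((⌈((n : ℝ) + t + 1) / a⌉ - ⌈((n : ℝ) + t) / a⌉).toNat : ℕ) : ℝ) := by
        exact_mod_cast hc
    _ ≤ ((⌈1 / a⌉ : ℤ) : ℝ) := by exact_mod_cast h3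
    _ ≤ 1 / a + 1 := h4.le

/-- The one-dimensional bound: `a Σ_{m ∈ T} (1 + |a m − t|)⁻² ≤ 8 Σ_{n ∈ ℤ} (1 + |n|)⁻²`. -/
private theorem riemannBound_oneDim (a : ℝ) (ha : 0 < a) (ha1 : a ≤ 1) (t : ℝ) (T : Finset ℤ) :
    a * ∑ m ∈ T, ((1 + |a * (m : ℝ) - t|)⁻¹) ^ 2 ≤
      8 * ∑' n : ℤ, ((1 + |(n : ℝ)|)⁻¹) ^ 2 := by
  set G := ∑' n : ℤ, ((1 + |(n : ℝ)|)⁻¹) ^ 2 with hG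
  set g : ℤ → ℝ := fun n => ((1 + |(n : ℝ)|)⁻¹) ^ 2 with hg
  set φ : ℤ → ℤ := fun m => ⌊a * (m : ℝ) - t⌋ with hφ
  have hg_nonneg : ∀ n, 0 ≤ g n := fun n => by
    simp only [hg]
    positivity
  have hpt : ∀ m : ℤ, ((1 + |a * (m : ℝ) - t|)⁻¹) ^ 2 ≤ 4 * g (φ m) := fun m =>
    riemannBound_weight_le_floor _
  have hcard : ∀ n : ℤ, ((#{m ∈ T | φ m = n} : ℕ) : ℝ) ≤ 1 / a + 1 := fun n =>
    riemannBound_card_fiber_le a t ha T n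
  have hsum_g : ∑ n ∈ T.image φ, g n ≤ G := by
    apply Summable.sum_le_tsum
    · intro n _
      exact hg_nonneg n
    · exact riemannBound_summable_weight
  have hS : 0 ≤ ∑ n ∈ T.image φ, g n := Finset.sum_nonneg (fun n _ => hg_nonneg n)
  calc a * ∑ m ∈ T, ((1 + |a * (m : ℝ) - t|)⁻¹) ^ 2
      ≤ a * ∑ m ∈ T, 4 * g (φ m) := by
        gcongr with m hm
        exact hpt m
    _ = a * ∑ n ∈ T.image φ, (#{m ∈ T | φ m = n} : ℕ) • (4 * g n) := by
        rw [Finset.sum_comp (fun n => 4 * g n) φ]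
    _ ≤ a * ∑ n ∈ T.image φ, (1 / a + 1) * (4 * g n) := by
        gcongr with n hn
        rw [nsmul_eq_mul]
        exact mul_le_mul_of_nonneg_right (hcard n) (by linarith [hg_nonneg n])
    _ = (1 + a) * 4 * ∑ n ∈ T.image φ, g n := by
        rw [← Finset.mul_sum, ← Finset.mul_sum]
        field_simp
    _ ≤ 2 * 4 * G := by
        gcongr
        linarith
    _ = 8 * G := by norm_num

/-- Coordinatewise domination: `(1 + ‖v‖)⁻⁸ ≤ ∏_μ (1 + |v μ|)⁻²` for `v = a x − c`. -/
private theorem riemannBound_coord_dom (a : ℝ) (c : EuclideanSpace ℝ (Fin 4)) (x : Site 4) :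
    ((1 + ‖a • siteToE x - c‖)⁻¹) ^ 8 ≤
      ∏ μ : Fin 4, ((1 + |a * ((x μ : ℤ) : ℝ) - c μ|)⁻¹) ^ 2 := by
  have hcoord : ∀ μ : Fin 4, (a • siteToE x - c) μ = a * ((x μ : ℤ) : ℝ) - c μ := by
    intro μ
    simp
  calc ((1 + ‖a • siteToE x - c‖)⁻¹) ^ 8
      = ∏ _μ : Fin 4, ((1 + ‖a • siteToE x - c‖)⁻¹) ^ 2 := by
        rw [Finset.prod_const, Finset.card_univ, Fintype.card_fin, ← pow_mul]
    _ ≤ ∏ μ : Fin 4, ((1 + |a * ((x μ : ℤ) : ℝ) - c μ|)⁻¹) ^ 2 := by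
        apply Finset.prod_le_prod (fun μ _ => by positivity)
        intro μ _
        rw [← hcoord μ]
        apply pow_le_pow_left₀ (by positivity)
        apply inv_anti₀ (by positivity)
        have := PiLp.norm_apply_le (a • siteToE x - c) μ
        rw [Real.norm_eq_abs] at this
        linarith

/-- **Stub `stub_riemannBound` (line `Sketch`).**  Riemann sums of the integrable weight
`(1 + ‖·‖)⁻⁸` over any finite set of lattice points are bounded uniformly in the mesh
`0 < a ≤ 1` and the centre `c`: `a⁴ Σ_{x ∈ Λ} (1 + ‖a x − c‖)⁻⁸ ≤ K`. -/
theorem stub_riemannBound :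
    ∃ K : ℝ, ∀ (a : ℝ), 0 < a → a ≤ 1 → ∀ (c : EuclideanSpace ℝ (Fin 4)) (Λ : Finset (Site 4)),
      a ^ 4 * ∑ x ∈ Λ, ((1 + ‖a • siteToE x - c‖)⁻¹) ^ 8 ≤ K := by
  set G := ∑' n : ℤ, ((1 + |(n : ℝ)|)⁻¹) ^ 2 with hG
  refine ⟨(8 * G) ^ 4, fun a ha ha1 c Λ => ?_⟩
  -- the coordinate projections of `Λ`
  set T : Fin 4 → Finset ℤ := fun μ => Λ.image (fun x => x μ) with hT
  have hsub : Λ ⊆ Fintype.piFinset T := by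
    intro x hx
    rw [Fintype.mem_piFinset]
    intro μ
    exact Finset.mem_image_of_mem _ hx
  have h1 : ∑ x ∈ Λ, ((1 + ‖a • siteToE x - c‖)⁻¹) ^ 8 ≤
      ∑ x ∈ Fintype.piFinset T, ∏ μ : Fin 4, ((1 + |a * ((x μ : ℤ) : ℝ) - c μ|)⁻¹) ^ 2 :=
    calc ∑ x ∈ Λ, ((1 + ‖a • siteToE x - c‖)⁻¹) ^ 8
        ≤ ∑ x ∈ Λ, ∏ μ : Fin 4, ((1 + |a * ((x μ : ℤ) : ℝ) - c μ|)⁻¹) ^ 2 :=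
          Finset.sum_le_sum (fun x _ => riemannBound_coord_dom a c x)
      _ ≤ ∑ x ∈ Fintype.piFinset T, ∏ μ : Fin 4, ((1 + |a * ((x μ : ℤ) : ℝ) - c μ|)⁻¹) ^ 2 := by
          apply Finset.sum_le_sum_of_subset_of_nonneg hsub
          intro x _ _
          exact Finset.prod_nonneg (fun μ _ => by positivity)
  have h2 : ∑ x ∈ Fintype.piFinset T, ∏ μ : Fin 4, ((1 + |a * ((x μ : ℤ) : ℝ) - c μ|)⁻¹) ^ 2 =
      ∏ μ : Fin 4, ∑ m ∈ T μ, ((1 + |a * (m : ℝ) - c μ|)⁻¹) ^ 2 :=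
    (Finset.prod_univ_sum T (fun μ m => ((1 + |a * ((m : ℤ) : ℝ) - c μ|)⁻¹) ^ 2)).symm
  have h3 : ∀ μ : Fin 4, a * ∑ m ∈ T μ, ((1 + |a * (m : ℝ) - c μ|)⁻¹) ^ 2 ≤ 8 * G := fun μ =>
    riemannBound_oneDim a ha ha1 (c μ) (T μ)
  calc a ^ 4 * ∑ x ∈ Λ, ((1 + ‖a • siteToE x - c‖)⁻¹) ^ 8
      ≤ a ^ 4 * ∏ μ : Fin 4, ∑ m ∈ T μ, ((1 + |a * (m : ℝ) - c μ|)⁻¹) ^ 2 := by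
        rw [← h2]
        gcongr
    _ = ∏ μ : Fin 4, (a * ∑ m ∈ T μ, ((1 + |a * (m : ℝ) - c μ|)⁻¹) ^ 2) := by
        rw [Finset.prod_mul_distrib, Finset.prod_const, Finset.card_univ, Fintype.card_fin]
    _ ≤ ∏ _μ : Fin 4, (8 * G) := by
        apply Finset.prod_le_prod
        · intro μ _
          exact mul_nonneg ha.le (Finset.sum_nonneg fun m _ => by positivity)
        · intro μ _
          exact h3 μ
    _ = (8 * G) ^ 4 := by
        rw [Finset.prod_const, Finset.card_univ, Fintype.card_fin]

end Summit.QuantumFields.YangMills.Theorems.ScalingWindowSplit.SelfNormalisedMomentBoundsR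

end
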